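import Summits.RiemannHypothesis.RiemannHypothesis.Theorems.WeilGroundStateGroundStatesConvergeToXiStubDoobPrime
import Summits.RiemannHypothesis.RiemannHypothesis.Theorems.WeilGroundStateGroundStatesConvergeToXiStubMellinXi
import Literature.NumberTheory.LFunctions.WeilExplicit
import Mathlib.Analysis.SpecialFunctions.Trigonometric.DerivHyp
import HarnessLib

/-!
# `WeilGroundState.GroundStatesConvergeToXi` — long-range Doob jump energies and the signed kernel
(crux item stmt-RiemannHypothesis-1527, route route-RiemannHypothesis-WeilGroundState; line `Sketch`,
stub `stub_doob_longRange` (G2); `--supports`)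

Dictionary (inline, no definitions): `Φ(t) = 2Ψ(2t)` is Riemann's kernel (real form
`2 * LagariasMontague.Psi (2 * t)`); for a test function `w` the `Φ`-weighted jump energy at lag
`h` is `I_w(h) = ∫ Φ(t) Φ(t+h) ‖w(t+h) − w(t)‖² dt`, and the signed archimedean–polar Lévy kernel
of the Doob form is `J(h) = e^{h/2}/(2 sinh h) − 2 cosh(h/2)`.

* (a) LONG RANGE (`doobLR_partA`, for a general continuous weight `φ`): if `tsupport w ⊆ [−R, R]`
  and `|h| > 2R`, the points `t` and `t + h` are never both in the support, so pointwise
  `‖w(t+h) − w(t)‖² = ‖w(t+h)‖² + ‖w(t)‖²` (`doobLR_pointwise`); integrating and substituting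
  `s = t + h` in the first piece (`integral_add_right_eq_self`),
  `I_w(h) = ∫ Φ(s) ‖w s‖² (Φ(s − h) + Φ(s + h)) ds`.  All integrands are continuous of compact
  support (`doobLR_integrable`).
* (b) ANTITONICITY (`doobLR_partB`): `e^{h/2}/(2 sinh h) = (e^{h/2} − e^{−3h/2})⁻¹`
  (`doobLR_archDensity_eq`) with a positive increasing denominator on `(0, ∞)`, and
  `h ↦ 2 cosh(h/2)` is monotone there (`Real.cosh_le_cosh`); antitone − monotone is antitone.

No new definitions; no named fact is used (Mathlib + `LagariasMontague.continuous_thetaSeries`).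
-/

noncomputable section

set_option linter.dupNamespace false

open scoped Topology Real
open Filter Set MeasureTheory Complex

namespace Summit.RiemannHypothesis.RiemannHypothesis.Theorems.GroundStatesConvergeToXi

open Literature.NumberTheory.LFunctions

/-! ## (a) Long range: the jump energy sees only `‖w‖²` -/

/-- Non-overlap: if `tsupport w ⊆ [−R, R]` and `|h| > 2R` then for every `t` one of `w t`,
`w (t + h)` vanishes, so `‖w(t+h) − w(t)‖² = ‖w(t+h)‖² + ‖w(t)‖²`. [folklore] -/
theorem doobLR_pointwise {w : ℝ → ℂ} {R h : ℝ} (hsupp : tsupport w ⊆ Icc (-R) R)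
    (hh : 2 * R < |h|) (t : ℝ) :
    ‖w (t + h) - w t‖ ^ 2 = ‖w (t + h)‖ ^ 2 + ‖w t‖ ^ 2 := by
  by_cases ht : t ∈ tsupport w
  · have hth : t + h ∉ tsupport w := fun hth => by
      have h1 := hsupp ht
      have h2 := hsupp hth
      rw [mem_Icc] at h1 h2
      have : |h| ≤ 2 * R := abs_le.2 ⟨by linarith, by linarith⟩
      linarith
    simp [image_eq_zero_of_notMem_tsupport hth]
  · simp [image_eq_zero_of_notMem_tsupport ht]

/-- A continuous real weight times `‖w‖²`, `w` a test function, is integrable (continuous of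
compact support). [folklore] -/
theorem doobLR_integrable {m : ℝ → ℝ} (hm : Continuous m) {w : ℝ → ℂ} (hw : IsWeilTest w) :
    Integrable fun s : ℝ => m s * ‖w s‖ ^ 2 := by
  refine (hm.mul (hw.1.continuous.norm.pow 2)).integrable_of_hasCompactSupport ?_
  refine hw.2.mono (Function.support_subset_iff'.2 fun x hx => ?_)
  rw [Function.notMem_support] at hx
  simp [hx]

/-- **Long range, general weight.** For a continuous real `φ`, a test function `w` with
`tsupport w ⊆ [−R, R]` and a lag `|h| > 2R`:
`∫ φ(t) φ(t+h) ‖w(t+h) − w(t)‖² dt = ∫ φ(s) ‖w s‖² (φ(s−h) + φ(s+h)) ds`. [folklore] -/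
theorem doobLR_partA_gen {φ : ℝ → ℝ} (hφc : Continuous φ) {w : ℝ → ℂ} {R h : ℝ}
    (hw : IsWeilTest w) (hsupp : tsupport w ⊆ Icc (-R) R) (hh : 2 * R < |h|) :
    ∫ t : ℝ, φ t * φ (t + h) * ‖w (t + h) - w t‖ ^ 2 =
      ∫ s : ℝ, φ s * ‖w s‖ ^ 2 * (φ (s - h) + φ (s + h)) := by
  have hF : Integrable fun s : ℝ => φ (s - h) * φ s * ‖w s‖ ^ 2 :=
    doobLR_integrable (by fun_prop) hw
  have hf2 : Integrable fun s : ℝ => φ s * φ (s + h) * ‖w s‖ ^ 2 :=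
    doobLR_integrable (by fun_prop) hw
  have hf1 : Integrable fun t : ℝ => φ (t + h - h) * φ (t + h) * ‖w (t + h)‖ ^ 2 :=
    hF.comp_add_right h
  have hlhs : (∫ t : ℝ, φ t * φ (t + h) * ‖w (t + h) - w t‖ ^ 2) =
      (∫ t : ℝ, φ (t + h - h) * φ (t + h) * ‖w (t + h)‖ ^ 2) +
        ∫ s : ℝ, φ s * φ (s + h) * ‖w s‖ ^ 2 := by
    rw [← integral_add hf1 hf2]
    refine integral_congr_ae (ae_of_all _ fun t => ?_)
    beta_reduce
    rw [doobLR_pointwise hsupp hh t, add_sub_cancel_right]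
    ring
  have hshift : (∫ t : ℝ, φ (t + h - h) * φ (t + h) * ‖w (t + h)‖ ^ 2) =
      ∫ s : ℝ, φ (s - h) * φ s * ‖w s‖ ^ 2 :=
    integral_add_right_eq_self (μ := volume) (fun s : ℝ => φ (s - h) * φ s * ‖w s‖ ^ 2) h
  rw [hlhs, hshift, ← integral_add hF hf2]
  refine integral_congr_ae (ae_of_all _ fun s => ?_)
  beta_reduce
  ring

/-- **Part (a) of stub G2.** For Riemann's kernel `Φ(t) = 2Ψ(2t)`, a test function `w` with
`tsupport w ⊆ [−R, R]` and a lag `|h| > 2R`, the `Φ`-weighted jump energy sees only `‖w‖²`: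
`I_w(h) = ∫ Φ(s) ‖w s‖² (Φ(s−h) + Φ(s+h)) ds`. [folklore] -/
theorem doobLR_partA (w : ℝ → ℂ) (R h : ℝ) (hw : IsWeilTest w) (hsupp : tsupport w ⊆ Icc (-R) R)
    (hh : 2 * R < |h|) :
    ∫ t : ℝ, 2 * LagariasMontague.Psi (2 * t) * (2 * LagariasMontague.Psi (2 * (t + h))) *
        ‖w (t + h) - w t‖ ^ 2 =
      ∫ s : ℝ, 2 * LagariasMontague.Psi (2 * s) * ‖w s‖ ^ 2 *
        (2 * LagariasMontague.Psi (2 * (s - h)) + 2 * LagariasMontague.Psi (2 * (s + h))) := by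
  have hφc : Continuous fun t : ℝ => 2 * LagariasMontague.Psi (2 * t) :=
    continuous_const.mul ((LagariasMontague.continuous_thetaSeries _).comp
      (continuous_const.mul continuous_id))
  exact doobLR_partA_gen hφc hw hsupp hh

/-! ## (b) The signed kernel is antitone on `(0, ∞)` -/

/-- `e^{h/2}/(2 sinh h) = (e^{h/2} − e^{−3h/2})⁻¹`. [folklore] -/
theorem doobLR_archDensity_eq (h : ℝ) :
    Real.exp (h / 2) / (2 * Real.sinh h) = (Real.exp (h / 2) - Real.exp (-(3 * h / 2)))⁻¹ := by
  have h1 : 2 * Real.sinh h =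
      Real.exp (h / 2) * (Real.exp (h / 2) - Real.exp (-(3 * h / 2))) := by
    rw [Real.sinh_eq, mul_sub, ← Real.exp_add, ← Real.exp_add]
    have e1 : h / 2 + h / 2 = h := by ring
    have e2 : h / 2 + -(3 * h / 2) = -h := by ring
    rw [e1, e2]
    ring
  rw [h1, div_mul_eq_div_div, div_self (Real.exp_pos _).ne', one_div]

/-- The archimedean jump density factor `h ↦ e^{h/2}/(2 sinh h)` is antitone on `(0, ∞)`.
[folklore] -/
theorem doobLR_archDensity_antitone :
    AntitoneOn (fun h : ℝ => Real.exp (h / 2) / (2 * Real.sinh h)) (Ioi 0) := by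
  intro x hx y hy hxy
  have hx0 : 0 < x := hx
  simp only [doobLR_archDensity_eq]
  refine inv_anti₀ ?_ ?_
  · have : Real.exp (-(3 * x / 2)) < Real.exp (x / 2) := Real.exp_lt_exp.2 (by linarith)
    linarith
  · have h1 : Real.exp (x / 2) ≤ Real.exp (y / 2) := Real.exp_le_exp.2 (by linarith)
    have h2 : Real.exp (-(3 * y / 2)) ≤ Real.exp (-(3 * x / 2)) :=
      Real.exp_le_exp.2 (by linarith)
    linarith

/-- **Part (b) of stub G2.** The signed archimedean–polar Lévy kernel
`J(h) = e^{h/2}/(2 sinh h) − 2 cosh(h/2)` is antitone on `(0, ∞)`. [folklore] -/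
theorem doobLR_partB :
    AntitoneOn (fun h : ℝ => Real.exp (h / 2) / (2 * Real.sinh h) - 2 * Real.cosh (h / 2))
      (Ioi 0) := by
  intro x hx y hy hxy
  have hx0 : 0 < x := hx
  have hy0 : 0 < y := hy
  have h1 : Real.exp (y / 2) / (2 * Real.sinh y) ≤ Real.exp (x / 2) / (2 * Real.sinh x) :=
    doobLR_archDensity_antitone hx hy hxy
  have h2 : Real.cosh (x / 2) ≤ Real.cosh (y / 2) := by
    rw [Real.cosh_le_cosh, abs_of_pos (by linarith), abs_of_pos (by linarith)]
    linarith
  show Real.exp (y / 2) / (2 * Real.sinh y) - 2 * Real.cosh (y / 2) ≤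
    Real.exp (x / 2) / (2 * Real.sinh x) - 2 * Real.cosh (x / 2)
  linarith

/-! ## The stub -/

/-- **Stub `stub_doob_longRange` (G2).** (a) For `w` supported in `[−R, R]` and a lag `|h| > 2R`
the two copies do not overlap, so the `Φ`-weighted jump energy sees only `‖w‖²`:
`I_w(h) = ∫ Φ(s)‖w(s)‖² (Φ(s−h) + Φ(s+h)) ds` (`Φ(t) = 2Ψ(2t)` Riemann's kernel).  (b) The signed
archimedean–polar kernel `J(h) = e^{h/2}/(2 sinh h) − 2cosh(h/2)` is antitone on `(0, ∞)`.
[folklore] -/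
theorem stub_doob_longRange :
    (∀ (w : ℝ → ℂ) (R h : ℝ), IsWeilTest w → tsupport w ⊆ Icc (-R) R → 2 * R < |h| →
      ∫ t : ℝ, 2 * LagariasMontague.Psi (2 * t) * (2 * LagariasMontague.Psi (2 * (t + h))) *
          ‖w (t + h) - w t‖ ^ 2 =
        ∫ s : ℝ, 2 * LagariasMontague.Psi (2 * s) * ‖w s‖ ^ 2 *
          (2 * LagariasMontague.Psi (2 * (s - h)) + 2 * LagariasMontague.Psi (2 * (s + h)))) ∧
    AntitoneOn (fun h : ℝ => Real.exp (h / 2) / (2 * Real.sinh h) - 2 * Real.cosh (h / 2)) (Ioi 0) :=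
  ⟨doobLR_partA, doobLR_partB⟩

end Summit.RiemannHypothesis.RiemannHypothesis.Theorems.GroundStatesConvergeToXi
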